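import Literature.AnabelianGeometry.AbsoluteAnabelian.AbsTopIII.FrobeniusPictureMLFShiftCompatible
import Literature.AnabelianGeometry.AbsoluteAnabelian.AbsTopIII.LogFrobeniusObservableProofs
import Literature.AnabelianGeometry.AbsoluteAnabelian.AbsTopIII.FrobeniusPictureMLFModelProofs

/-!
# [AbsTopIII] Corollary 3.6 (v), third sentence `ShiftCompatStmt`: from the named fact `IotaOverGaloisStmt`
# alone, and UNCONDITIONALLY at the MLF model `𝒳 = 𝒞^{MLF-sB}_T`

S. Mochizuki, *Topics in Absolute Anabelian Geometry III*, Cor. 3.6 (v) p. 80 (`MochizukiAbsTopIII2015`, kurims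
manuscript `paper:url-5493eb38cbb7`): "the self-equivalences in these nexus-classes are compatible with the
families of homotopies that constitute the cores and observable of (i), (iii)".  Seat abc-iut-w6-d023, row
«Cor36-SHIFT», closing file: `FrobeniusPictureMLFShiftCompatible.lean` proves `ShiftCompatStmt` for every `Δ`
satisfying `IotaOverGaloisStmt` and every `𝔖_log` family `H₃`; the `𝔖_log` family EXISTS for every `Δ`
(abc-iut-w4-d095, `LogFrobeniusData.observableLogStmt`), so

* `shiftCompatStmt_of_iotaOverGaloisStmt : Δ.IotaOverGaloisStmt → Δ.ShiftCompatStmt` — Cor. 3.6 (v), third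
  sentence, conditional on the single NAMED FACT F-0360 (the `h₃` binder of abc-iut-w6-d025's
  `AbsTopIII.cor_4_5_v_compat_of_shiftCompat`, Cor. 4.5 (v) being the same statement on archimedean data);
* `AbsTopIII.TFModel.shiftCompatStmt_model` — UNCONDITIONAL at the MLF model data of abc-iut-L4-t5's
  `FrobeniusPictureMLFModel.lean` (every type `P`, every Cor-1.10 datum `I`), by `TFModel.iotaOverGaloisStmt_model`.
  (The (iii) cores clause at the model follows from the same chain — abc-iut-w5-d053 / abc-iut-L4-t5's row; the
  joint form is `logObsCompatCores_and_shiftCompat_of_iotaOverGalois` of the previous file.)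

HONEST SCOPE: over abstract `Δ` the only hypothesis is the named fact `IotaOverGaloisStmt`; at the model there is
none.  Nothing here bears on [IUTchIII] Cor. 3.12; no side is taken on inter-universal Teichmüller theory; typed
≠ endorsed.
-/

namespace Literature.AnabelianGeometry.AbsoluteAnabelian

open _root_.CategoryTheory _root_.Quiver

universe u

namespace LogFrobeniusData

open DiagramOfCategories

variable (Δ : LogFrobeniusData.{u})

/-- **[AbsTopIII] Cor. 3.6 (v), third sentence, from the named fact `IotaOverGaloisStmt` alone** (the `𝔖_log`
family exists for every `Δ`: `observableLogStmt`). [cite: MochizukiAbsTopIII2015, Corollary 3.6 (v) p.80] -/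
theorem shiftCompatStmt_of_iotaOverGaloisStmt (hι : Δ.IotaOverGaloisStmt) :
    Literature.AnabelianGeometry.AbsoluteAnabelian.LogFrobeniusData.ShiftCompatStmt Δ := by
  obtain ⟨H₃, hH₃⟩ := Δ.observableLogStmt_iff.mp Δ.observableLogStmt
  exact shiftCompatStmt_of_iotaOverGalois hH₃ hι

end LogFrobeniusData

namespace AbsTopIII

namespace TFModel

variable {p : ℕ} [Fact p.Prime] {P : ObjectProperty (TFModel p)} {D : Type 1} [Category.{1} D]

/-- **[AbsTopIII] Cor. 3.6 (v), third sentence, AT THE MLF MODEL — UNCONDITIONAL**: for the model data of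
abc-iut-L4-t5's `FrobeniusPictureMLFModel.lean` (every type `P` of MLF-Galois `TM`-pairs, every Cor-1.10 datum
`I`), the nexus self-equivalences translating the first row are compatible (Def. 3.5 (v)) with a family of
homotopies realising the cores of (i) and the observable `𝔖_log` of (iii).
[cite: MochizukiAbsTopIII2015, Corollary 3.6 (v) p.80] -/
theorem shiftCompatStmt_model (I : AnabelianInput p P D) :
    (monoAnabelianData I).toLogFrobeniusData.ShiftCompatStmt :=
  LogFrobeniusData.shiftCompatStmt_of_iotaOverGaloisStmt _ (iotaOverGaloisStmt_model I)

end TFModel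

end AbsTopIII

end Literature.AnabelianGeometry.AbsoluteAnabelian
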